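import Literature.NumberTheory.Rogawski1990.ArchExplicitTransferFactorConjRight   -- ★ (B-p12): `archExplicitDelta_conj_right` (+ ★ `ArchExplicitTransferFactor`: `archExplicitDelta`, `archExplicitDelta_conj_left`)
import Literature.NumberTheory.Automorphic.ArchInnerFormCartanAtlasWeyl            -- ★ p849857 (this seat, (NEGX-CONJ)): `gprimeTorus_negXAt_eq_conj`
import HarnessLib

/-!
# `Δ″_∞` does not see the realised split reflection on the `G′` side: `Δ″(γ_H, gprimeTorus α S′ (negXAt w c)) = Δ″(γ_H, gprimeTorus α S′ c)`
# ((Δ-NEGX-G′) — the `hΔnegG` hypothesis of the (W)-clause ★ `archBzWeyl_transfFam`; Rogawski 1990 §4.3, §4.9; Shelstad 1979 §4)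

Topic `NumberTheory/Rogawski1990`; namespace `Literature.NumberTheory.Rogawski1990`.  THEOREMS ONLY (no definition, no instance, no notation, no axiom, no named fact, no `sorry`);
kernel lane `--kind proof --supports stmt-HodgeConjecture-24833`.  Cell `pub/hodgecm-mathlib`, crux H413 (`stmt-HodgeConjecture-24833`), F0∕P3c line LH3, DIRECT ROAD of `stub_N9`;
seat LH4-p01 (g2), follow-up (Δ-NEGX-G′) of (NEGX-CONJ) ★ p849857 (LH3-plan (g2) ruling (6) 2026-09-02T06:28:37Z: «(W)'s hypotheses are (Δ-STABLE) + `hΔnegH`∕`hΔnegG` (= `hl`∕`hr` +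
(NEGX-CONJ)) + `hcont`»).  Count-neutral.

THE MATHEMATICS.  `Δ″_∞(γ_H, γ′)` is a class function of `γ′ ∈ G′_∞` (★ `archExplicitDelta_conj_right`).  At a SPLIT place `w` the coordinate reflection `x_w ↦ −x_w` (★ (COORD)
`negXAt w`) moves the chart point of `G′_∞ = U(diag α)(L⁺ ⊗ ℝ)` to a CONJUGATE one (★ p849857 `gprimeTorus_negXAt_eq_conj`: the sign matrix `diag(1, 1, −1)` of the boost plane at
`w`) — for `w` a SPLIT-CHART place of the frame (`w ∈ splitChartPlaces L α`: only there is the `w`-component of `gprimeTorus α S′ c` the boost; at a place of `S′` that is not a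
split-chart place the component is the compact chart, `x_w` is an eigenvalue ANGLE and `x_w ↦ −x_w` is not a conjugation — so the identity is GUARDED, as LH3-plan (g2)'s ruling (1)
guards `orbFamG`).  Hence:
* `archExplicitDelta_gprimeTorus_negXAt (hw : w ∈ S′) (hsp : w ∈ splitChartPlaces L α) (γ_H) (c)` — the (W)-clause's `hΔnegG` at one chart under the split-chart guard;
* `archExplicitDelta_gprimeTorus_negXAt_of_forall (hS′ : ∀ w, w ∈ S′ → w ∈ splitChartPlaces L α) (hw : w ∈ S′)` — the same with the chart-level guard (by-paste test: under
  `hfr : ∀ S, ∀ w ∈ S, w ∈ splitChartPlaces L α` the (W) binder text `hΔnegG` of ★ `ArchTransfFamilyWeyl` :188–:190 is `fun S _ c γH hw => …_of_forall L α μ (hfr S) hw γH c`).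
The `H`-side twin `hΔnegH` (and `hΔflip`) is ★ p849871 `ArchExplicitTransferFactorStable` (LH10-p02 (g3): `archExplicitDelta_endoTorus_negXAt`, `…_flipAt`) — NOT restated here.
HONEST LABEL: HC_CM is proved only modulo the 7 printed citations (2 remaining: hLiu418 = `stmt-HodgeConjecture-24832`, h413 = `stmt-HodgeConjecture-24833`) until rung 0 closes; this file
discharges one hypothesis of an in-house (W)-clause, nothing printed (+0∕+0).

## References
* [Rogawski1990] J. D. Rogawski, *Automorphic Representations of Unitary Groups in Three Variables*, Ann. of Math. Stud. 123 (1990), §4.3 (4.3.1) p. 43 (transfer factors and orbital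
  integrals are class functions), §4.9 p. 55 (`Δ″_∞`), §3.6 p. 31.
* [Shelstad1979] D. Shelstad, *Characters and inner forms of a quasi-split group over ℝ*, Compositio Math. 39 (1979), §4 p. 23 (realised Weyl reflections of a Cartan subgroup).
-/

set_option autoImplicit false

noncomputable section

open NumberField NumberField.InfinitePlace Matrix Complex
open scoped MatrixGroups Matrix Classical Real
open Literature.NumberTheory.Automorphic Literature.NumberTheory.Automorphic.UnitaryGroup Literature.NumberTheory.Automorphic.ArchCartan
open Literature.NumberTheory.GaloisRepresentations

namespace Literature.NumberTheory.Rogawski1990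

variable (L : Type) [Field L] [NumberField L] [IsCMField L]

/-! ## `G′`-side: `hΔnegG` under the split-chart guard -/

variable (α : Fin 3 → L) (μ : HeckeCharacter L)

/-- **`Δ″_∞(γ_H, gprimeTorus α S′ (negXAt w c)) = Δ″_∞(γ_H, gprimeTorus α S′ c)`** for `w ∈ S′` a split-chart place — the (W)-clause's `hΔnegG` under the guard: the reflected chart
point is `G′_∞`-conjugate to the original (★ `gprimeTorus_negXAt_eq_conj`, conjugator `gprimeTorus α ∅ (Pi.single w (0,0,π))`) and `Δ″_∞` is a class function of `γ′`
(★ `archExplicitDelta_conj_right`). [cite: Rogawski1990, §4.3 (4.3.1) p. 43; §4.9 p. 55] [cite: Shelstad1979, §4 p. 23] -/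
theorem archExplicitDelta_gprimeTorus_negXAt {S' : Finset {w : InfinitePlace L // IsComplex w}} {w : {w : InfinitePlace L // IsComplex w}} (hw : w ∈ S')
    (hsp : w ∈ splitChartPlaces L α)
    (γH : ↥(UnitaryGroup.arch (↥(maximalRealSubfield L)) L (IsCMField.complexConj L) 2 (Matrix.of fun i j : Fin 2 => if i.val + j.val + 1 = 2 then (1 : L) else 0)) ×
      ↥(UnitaryGroup.arch (↥(maximalRealSubfield L)) L (IsCMField.complexConj L) 1 (Matrix.of fun i j : Fin 1 => if i.val + j.val + 1 = 1 then (1 : L) else 0)))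
    (c : {w : InfinitePlace L // IsComplex w} → Fin 3 → ℝ) :
    archExplicitDelta L (Matrix.diagonal α) γH μ (gprimeTorus L α S' (negXAt w c)) = archExplicitDelta L (Matrix.diagonal α) γH μ (gprimeTorus L α S' c) := by
  rw [gprimeTorus_negXAt_eq_conj L α hw hsp c]
  exact archExplicitDelta_conj_right L (Matrix.diagonal α) μ γH _ _

/-- The same with the chart-level guard `∀ w ∈ S′, w ∈ splitChartPlaces L α` (the shape of ★ `exists_conj_gprimeTorus_negXAt` ∕ ruling (1)'s `orbFamG` guard).
[cite: Rogawski1990, §4.3 (4.3.1) p. 43] -/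
theorem archExplicitDelta_gprimeTorus_negXAt_of_forall {S' : Finset {w : InfinitePlace L // IsComplex w}} (hS' : ∀ w, w ∈ S' → w ∈ splitChartPlaces L α)
    {w : {w : InfinitePlace L // IsComplex w}} (hw : w ∈ S')
    (γH : ↥(UnitaryGroup.arch (↥(maximalRealSubfield L)) L (IsCMField.complexConj L) 2 (Matrix.of fun i j : Fin 2 => if i.val + j.val + 1 = 2 then (1 : L) else 0)) ×
      ↥(UnitaryGroup.arch (↥(maximalRealSubfield L)) L (IsCMField.complexConj L) 1 (Matrix.of fun i j : Fin 1 => if i.val + j.val + 1 = 1 then (1 : L) else 0)))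
    (c : {w : InfinitePlace L // IsComplex w} → Fin 3 → ℝ) :
    archExplicitDelta L (Matrix.diagonal α) γH μ (gprimeTorus L α S' (negXAt w c)) = archExplicitDelta L (Matrix.diagonal α) γH μ (gprimeTorus L α S' c) :=
  archExplicitDelta_gprimeTorus_negXAt L α μ hw (hS' w hw) γH c

end Literature.NumberTheory.Rogawski1990

end
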